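import Literature.NumberTheory.EllipticCurves.PadicSigmaKohelCriterionProofs
import Literature.NumberTheory.EllipticCurves.VeluKernelReductionProofs
import Literature.NumberTheory.EllipticCurves.FormalGroupChartUniquenessProofs
import HarnessLib

/-!
# From the output of `VeluKernelReductionProofs` to `mazur_tate_sigma_existsUnique`
# (Blakestad–Grant 2023, Thm. 1: the last purely algebraic mile; proofs only)

Trunk T-NT-EC (Literature/NumberTheory/EllipticCurves). `VeluKernelReductionProofs` ends
Blakestad–Grant's Prop. 7 / Lemma 12 with POLYNOMIAL and POWER-SERIES data over the base ring `𝒪`: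
lifts `U₀, M₀ ∈ 𝒪[X]`, `A₀, B₀ ∈ 𝒪` of Vélu's numerators and coefficients (`U₀ ≡ Xᵖ`, `M₀ ≡ fⁿ`,
`A₀ℓ₀⁴ ≡ A₄ᵖ`, `B₀ℓ₀⁶ ≡ A₆ᵖ (mod p)`, `f·M₀² = U₀³ + A₀U₀φ⁴ + B₀φ⁶`) and the formal isogeny
`t_p = veluFormalIsog = t·Φ·u` (`u = veluFormalUnit ≡ 1`, `t_p ≡ ℓ₀tᵖ`).
`PadicSigmaKohelCriterionProofs` wants, for `𝓔' = α_*𝓔`, `T'`, `u`, `π`, the kernel polynomial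
`D` and `U`: `T' ≡ tᵖ`, `u ≡ 1`, `T' = πt·ev_n(D)·u`, `ω'(T')dT' = πω`, `X'(T') = ev_p(U)·u²`,
`U = (pX - T₀)D² - 𝓛(D)`. This file performs the remaining purely algebraic identifications over
`R̂ = completeRing p` (no points, no valuations):

* `sq_velu_image` — **`P² = P³ + A₀·t_p⁴·P + B₀·t_p⁶`** for `P = 𝒰·u²` (`𝒰 = ev_p U₀`): the
  cleared Weierstrass equation of `ψ` of the formal point on `E'_p : y² = x³ + A₀x + B₀` (from
  `f·M₀² = U₀³ + A₀U₀φ⁴ + B₀φ⁶` evaluated at level `3p`, and `u·X·ℳ = 𝒰`);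
* `formalEta_mul_velu_image` — **`η·(t_p·P^• - 2P·t_p^•) = -2p·P`**, i.e. `ψ^*ω_p = pω`
  (`dξ/(2υ) = pω` for `(ξ, υ) = (x_p(t), y_p(t))`), from the normalisation `U'φ - 2Uφ' = pM`
  (`veluMD = U'D - 2UD'`) and `Dx = 2y` via the pole-cleared derivations `𝒟_{2p}𝒰 = -2ev_p(xU')`,
  `𝒟_{2n}Φ = -2ev_n(xφ')`;
* **`coeff_exp_sigmaExpArg_universalCurve_mem_of_veluKernelData`** and
  **`mazur_tate_sigma_existsUnique_of_veluKernelData`** — with `A'₄ = A₀ℓ₀⁴`, `A'₆ = B₀ℓ₀⁶`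
  (`α = frobeniusLift`), `T' = ℓ₀⁻¹t_p`, `π = p/ℓ₀`, `pD = φ`: the chart of `𝓔'` read through `T'`
  (`formalXMulSq_subst_eq_of_sq_eq`, `formalEta_subst_mul_eq` of `FormalGroupChartUniquenessProofs`)
  gives `X'(T') = P` and `ω'(T')dT' = πω`; `clearedEval_logForm` + `formalXReg_rel_of_velu` give the
  Vélu-level identity; Prop. 13 and Thm. 1 (`coeff_exp_sigmaExpArg_universalCurve_mem'`) conclude.

So the named fact now needs exactly ONE thing on Blakestad–Grant's route: an instance of the
hypotheses of `VeluKernelReductionProofs` for `𝓔 = universalCurve p` over `R̂` — the canonical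
subgroup as a finite subgroup `G` of points over a field `F ⊇ Frac R̂` with kernel polynomial `D`,
`p·D ∈ R̂[X]`, `p·D ≡ ℓ₀ ∈ R̂ˣ (mod p)` (their (4)), `#G = p` — and the descent of `U`, `M_D`, `a'`,
`b'` along `R̂ → F` provided there (`exists_veluU_lift`, `exists_veluMD_lift`, `exists_veluAB_lift`),
together with `veluU_eq_logForm` for `T₀`.

## Sources

* C. Blakestad, D. Grant, *On the universal `p`-adic sigma and Weierstrass zeta functions*,
  J. Number Theory 249 (2023) 348–376 (arXiv:1903.02480): Prop. 7 (a)–(c), Lemma 12, Prop. 13,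
  proof of Thm. 1. [BlakestadGrant2023]
* J. Vélu, C. R. Acad. Sci. Paris 273 (1971) 238–241 (`ψ^*ω₁ = ω`). [Velu1971]
* B. Mazur, W. Stein, J. Tate, Doc. Math. Extra Vol. Coates (2006), Thm. 1.3. [MazurSteinTate2006]

Pure proof file: no definitions, no named facts.
-/

noncomputable section

open PowerSeries Literature.NumberTheory.EllipticCurves
open scoped Polynomial

namespace WeierstrassCurve

/-! ### The image of the formal point under `ψ`, in cleared form -/

section ImagePoint

variable {𝒪 : Type*} [CommRing 𝒪] (W : WeierstrassCurve 𝒪)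

/-- `[z¹](F^d) = 0` when `[z¹]F = 0`. [folklore] -/
theorem _root_.Literature.NumberTheory.EllipticCurves.coeff_one_pow_eq_zero {F : 𝒪⟦X⟧}
    (h1 : coeff 1 F = 0) (d : ℕ) : coeff 1 (F ^ d) = 0 := by
  induction d with
  | zero => rw [pow_zero, coeff_one, if_neg one_ne_zero]
  | succ d ih =>
    rw [pow_succ, coeff_mul, Finset.Nat.sum_antidiagonal_eq_sum_range_succ_mk, Finset.sum_range_succ,
      Finset.sum_range_one, coeff_zero_eq_constantCoeff_apply, Nat.sub_zero, h1, mul_zero, zero_add, Nat.sub_self,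
      ih, zero_mul]

/-- `ev` commutes with ring maps. [folklore] -/
theorem map_clearedEval {S : Type*} [CommRing S] (φ : 𝒪 →+* S) {d : ℕ} {g : 𝒪[X]} (hg : g.natDegree ≤ d) :
    PowerSeries.map φ (W.clearedEval d g) = (W.map φ).clearedEval d (g.map φ) := by
  rw [W.clearedEval_eq_sum hg, (W.map φ).clearedEval_eq_sum ((Polynomial.natDegree_map_le).trans hg), map_sum]
  refine Finset.sum_congr rfl fun k _ => ?_
  rw [map_mul, map_C, map_mul, map_pow, map_pow, map_X, W.map_formalXMulSq φ, Polynomial.coeff_map]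

variable [W.IsShortNF]

/-- `[z¹] ev_d(g) = 0` on a short model (`X = 1 - a₁z - ⋯` with `a₁ = 0`; all other terms carry `z²`).
[folklore] -/
theorem coeff_one_clearedEval {d : ℕ} {g : 𝒪[X]} (hg : g.natDegree ≤ d) : coeff 1 (W.clearedEval d g) = 0 := by
  rw [W.clearedEval_eq_sum hg, map_sum]
  refine Finset.sum_eq_zero fun k hk => ?_
  have hk' : k ≤ d := Nat.lt_succ_iff.mp (Finset.mem_range.mp hk)
  rw [coeff_C_mul]
  rcases Nat.eq_or_lt_of_le hk' with rfl | hlt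
  · rw [Nat.sub_self, mul_zero, pow_zero, mul_one,
      coeff_one_pow_eq_zero (by rw [W.coeff_one_formalXMulSq, W.a₁_of_isShortNF, neg_zero]),
      mul_zero]
  · rw [mul_comm (W.formalXMulSq ^ k), coeff_X_pow_mul', if_neg (by omega), mul_zero]

variable {W}
variable {φO U₀ M₀ : 𝒪[X]} {A₀ B₀ : 𝒪} {p n : ℕ}

/-- `rhsCubic` of a short model is `X³ + a₄X + a₆`. [folklore] -/
theorem rhsCubic_of_isShortNF : W.rhsCubic = Polynomial.X ^ 3 + Polynomial.C W.a₄ * Polynomial.X + Polynomial.C W.a₆ := by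
  rw [rhsCubic_def, W.a₂_of_isShortNF, Polynomial.C_0, zero_mul, add_zero]

/-- **The cleared Weierstrass equation of `ψ` of the formal point.** From Blakestad–Grant's model
`E'_p : y_p² = x_p³ + A₀x_p + B₀`, `x_p = U/φ²`, `y_p = yM/φ³`, i.e. the polynomial identity
`f·M² = U³ + A₀Uφ⁴ + B₀φ⁶` (`VeluKernelReductionProofs.exists_veluAB_lift`), the series
`P = 𝒰·u²` (`𝒰 = ev_p U`, `u = veluFormalUnit`: `P = t_p²·x_p(t)`) and `t_p = t·Φ·u`
(`veluFormalIsog`) satisfy **`P² = P³ + A₀·t_p⁴·P + B₀·t_p⁶`**.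
[Blakestad–Grant 2023, Prop. 7 (a),(c)] [cite: BlakestadGrant2023, Prop. 7] -/
theorem sq_velu_image (hp : 2 * n + 1 = p) (hφ : φO.natDegree ≤ n) (hU : U₀.natDegree ≤ p)
    (hM : M₀.natDegree ≤ 3 * n) (hM1 : M₀.coeff (3 * n) = 1)
    (hAB : (Polynomial.X ^ 3 + Polynomial.C W.a₄ * Polynomial.X + Polynomial.C W.a₆) * M₀ ^ 2 =
      U₀ ^ 3 + Polynomial.C A₀ * U₀ * φO ^ 4 + Polynomial.C B₀ * φO ^ 6) :
    (W.clearedEval p U₀ * W.veluFormalUnit U₀ M₀ p n ^ 2) ^ 2 =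
      (W.clearedEval p U₀ * W.veluFormalUnit U₀ M₀ p n ^ 2) ^ 3 +
        C A₀ * W.veluFormalIsog φO U₀ M₀ p n ^ 4 * (W.clearedEval p U₀ * W.veluFormalUnit U₀ M₀ p n ^ 2) +
        C B₀ * W.veluFormalIsog φO U₀ M₀ p n ^ 6 := by
  set 𝒰 := W.clearedEval p U₀ with h𝒰
  set Φ := W.clearedEval n φO with hΦ
  set ℳ := W.clearedEval (3 * n) M₀ with hℳ
  set u := W.veluFormalUnit U₀ M₀ p n with hu
  have htp : W.veluFormalIsog φO U₀ M₀ p n = X * Φ * u := rfl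
  have hunit : u * (W.formalXMulSq * ℳ) = 𝒰 := veluFormalUnit_mul hM hM1
  -- evaluate the polynomial identity at level `3p`
  have hf : W.rhsCubic = Polynomial.X ^ 3 + Polynomial.C W.a₄ * Polynomial.X + Polynomial.C W.a₆ := rhsCubic_of_isShortNF
  have hdegf : (Polynomial.X ^ 3 + Polynomial.C W.a₄ * Polynomial.X + Polynomial.C W.a₆ : 𝒪[X]).natDegree ≤ 3 := by
    rw [← hf]; exact W.natDegree_rhsCubic_le
  have hM2 : (M₀ ^ 2).natDegree ≤ 3 * n + 3 * n := (Polynomial.natDegree_pow_le_of_le 2 hM).trans (by omega)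
  have hφ4 : (φO ^ 4).natDegree ≤ 4 * n := (Polynomial.natDegree_pow_le_of_le 4 hφ).trans (by omega)
  have hφ6 : (φO ^ 6).natDegree ≤ 6 * n := (Polynomial.natDegree_pow_le_of_le 6 hφ).trans (by omega)
  have hL : W.clearedEval (3 * p) ((Polynomial.X ^ 3 + Polynomial.C W.a₄ * Polynomial.X + Polynomial.C W.a₆) * M₀ ^ 2) =
      W.formalXMulSq ^ 2 * ℳ ^ 2 := by
    rw [show 3 * p = 3 + (3 * n + 3 * n) by omega, W.clearedEval_mul hdegf hM2, ← hf, clearedEval_rhsCubic_eq_sq,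
      pow_two M₀, W.clearedEval_mul hM hM, ← hℳ, pow_two ℳ]
  have hR1 : W.clearedEval (3 * p) (U₀ ^ 3) = 𝒰 ^ 3 := by
    rw [show 3 * p = p + p + p by omega, pow_three', W.clearedEval_mul ((Polynomial.natDegree_mul_le).trans
      (add_le_add hU hU)) hU, W.clearedEval_mul hU hU, ← h𝒰]
    ring
  have hR2 : W.clearedEval (3 * p) (Polynomial.C A₀ * U₀ * φO ^ 4) = X ^ 4 * (C A₀ * 𝒰 * Φ ^ 4) := by
    rw [show 3 * p = (p + 4 * n) + 2 by omega, W.clearedEval_add_right 2 (by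
        rw [mul_assoc]; exact (Polynomial.natDegree_C_mul_le _ _).trans (Polynomial.natDegree_mul_le.trans (add_le_add hU hφ4))),
      mul_assoc, clearedEval_C_mul, W.clearedEval_mul hU hφ4, ← h𝒰,
      show 4 * n = n + n + n + n by ring, show φO ^ 4 = φO * φO * φO * φO by ring,
      W.clearedEval_mul ((Polynomial.natDegree_mul_le).trans (add_le_add ((Polynomial.natDegree_mul_le).trans
        (add_le_add hφ hφ)) hφ)) hφ,
      W.clearedEval_mul ((Polynomial.natDegree_mul_le).trans (add_le_add hφ hφ)) hφ, W.clearedEval_mul hφ hφ, ← hΦ]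
    ring
  have hR3 : W.clearedEval (3 * p) (Polynomial.C B₀ * φO ^ 6) = X ^ 6 * (C B₀ * Φ ^ 6) := by
    rw [show 3 * p = 6 * n + 3 by omega, W.clearedEval_add_right 3 ((Polynomial.natDegree_C_mul_le _ _).trans hφ6),
      clearedEval_C_mul, show 6 * n = n + n + n + n + n + n by ring,
      show φO ^ 6 = φO * φO * φO * φO * φO * φO by ring,
      W.clearedEval_mul ((Polynomial.natDegree_mul_le).trans (add_le_add ((Polynomial.natDegree_mul_le).trans
        (add_le_add ((Polynomial.natDegree_mul_le).trans (add_le_add ((Polynomial.natDegree_mul_le).trans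
        (add_le_add hφ hφ)) hφ)) hφ)) hφ)) hφ,
      W.clearedEval_mul ((Polynomial.natDegree_mul_le).trans (add_le_add ((Polynomial.natDegree_mul_le).trans
        (add_le_add ((Polynomial.natDegree_mul_le).trans (add_le_add hφ hφ)) hφ)) hφ)) hφ,
      W.clearedEval_mul ((Polynomial.natDegree_mul_le).trans (add_le_add ((Polynomial.natDegree_mul_le).trans
        (add_le_add hφ hφ)) hφ)) hφ,
      W.clearedEval_mul ((Polynomial.natDegree_mul_le).trans (add_le_add hφ hφ)) hφ, W.clearedEval_mul hφ hφ, ← hΦ]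
    ring
  have hev := congrArg (W.clearedEval (3 * p)) hAB
  rw [hL, clearedEval_add, clearedEval_add, hR1, hR2, hR3] at hev
  -- `X²ℳ²·u² = 𝒰²`; multiply by `u⁶`
  rw [htp]
  linear_combination u ^ 6 * hev -
    (u * (W.formalXMulSq * ℳ) + 𝒰) * u ^ 4 * hunit

/-- **`ψ^*ω_p = p·ω`, cleared** (Blakestad–Grant: "`ψ^*ω' = (p/H)ω`"; Vélu's normalisation
`y₁ = y·(x₁)'`, here `U'φ - 2Uφ' = p·M`, i.e. `(U/φ²)' = pM/φ³`): with `P = 𝒰u²` and `t_p = tΦu`,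
**`η·(t_p·P^• - 2P·t_p^•) = -2p·P`** (`η = dz/ω`; this is `dξ/(2υ) = pω` for `ξ = x_p(t)`,
`υ = y_p(t)`, since `Dx = 2y`). [Blakestad–Grant 2023, Prop. 7 (c); Vélu 1971]
[cite: BlakestadGrant2023, Prop. 7] -/
theorem formalEta_mul_velu_image (hp : 2 * n + 1 = p) (hφ : φO.natDegree ≤ n) (hU : U₀.natDegree ≤ p)
    (hM : M₀.natDegree ≤ 3 * n) (hM1 : M₀.coeff (3 * n) = 1)
    (hMder : Polynomial.derivative U₀ * φO - 2 * U₀ * Polynomial.derivative φO = Polynomial.C (p : 𝒪) * M₀) :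
    W.formalEta * (W.veluFormalIsog φO U₀ M₀ p n * d⁄dX 𝒪 (W.clearedEval p U₀ * W.veluFormalUnit U₀ M₀ p n ^ 2) -
      2 * (W.clearedEval p U₀ * W.veluFormalUnit U₀ M₀ p n ^ 2) * d⁄dX 𝒪 (W.veluFormalIsog φO U₀ M₀ p n)) =
      -2 * C (p : 𝒪) * (W.clearedEval p U₀ * W.veluFormalUnit U₀ M₀ p n ^ 2) := by
  haveI : W.IsCharNeTwoNF := ⟨W.a₁_of_isShortNF, W.a₃_of_isShortNF⟩
  set 𝒰 := W.clearedEval p U₀ with h𝒰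
  set Φ := W.clearedEval n φO with hΦ
  set ℳ := W.clearedEval (3 * n) M₀ with hℳ
  set u := W.veluFormalUnit U₀ M₀ p n with hu
  have htp : W.veluFormalIsog φO U₀ M₀ p n = X * Φ * u := rfl
  have hunit : u * (W.formalXMulSq * ℳ) = 𝒰 := veluFormalUnit_mul hM hM1
  -- `𝒟_{2p}𝒰 = -2ev_p(xU')`, `𝒟_{2n}Φ = -2ev_n(xφ')`
  have hDU := W.clearedDeriv_clearedEval_eq hU
  have hDΦ := W.clearedDeriv_clearedEval_eq hφ
  rw [← h𝒰] at hDU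
  rw [← hΦ] at hDΦ
  -- `Φ·ev_p(xU') - 2𝒰·ev_n(xφ') = ev_{n+p}(x(U'φ - 2Uφ')) = p·X·ℳ`
  have hXd : ∀ {Q : 𝒪[X]} {d : ℕ}, Q.natDegree ≤ d → (Polynomial.X * Polynomial.derivative Q).natDegree ≤ d := by
    intro Q d hQ
    by_cases h0 : Q.natDegree = 0
    · rw [Polynomial.derivative_of_natDegree_zero h0, mul_zero, Polynomial.natDegree_zero]; exact Nat.zero_le _
    · refine (Polynomial.natDegree_mul_le).trans ?_
      have := Polynomial.natDegree_derivative_le Q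
      have h1 : (Polynomial.X : 𝒪[X]).natDegree ≤ 1 := Polynomial.natDegree_X_le
      omega
  have hXU : (Polynomial.X * Polynomial.derivative U₀).natDegree ≤ p := hXd hU
  have hXφ : (Polynomial.X * Polynomial.derivative φO).natDegree ≤ n := hXd hφ
  have hkey : Φ * W.clearedEval p (Polynomial.X * Polynomial.derivative U₀) -
      2 * 𝒰 * W.clearedEval n (Polynomial.X * Polynomial.derivative φO) =
      C (p : 𝒪) * (W.formalXMulSq * ℳ) := by
    have h1 : W.clearedEval (n + p) (φO * (Polynomial.X * Polynomial.derivative U₀)) =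
        Φ * W.clearedEval p (Polynomial.X * Polynomial.derivative U₀) := by rw [W.clearedEval_mul hφ hXU, ← hΦ]
    have h2 : W.clearedEval (n + p) (U₀ * (Polynomial.X * Polynomial.derivative φO)) =
        𝒰 * W.clearedEval n (Polynomial.X * Polynomial.derivative φO) := by
      rw [add_comm, W.clearedEval_mul hU hXφ, ← h𝒰]
    have h3 : W.clearedEval (n + p) (Polynomial.X * (Polynomial.C (p : 𝒪) * M₀)) = C (p : 𝒪) * (W.formalXMulSq * ℳ) := by
      rw [show n + p = 3 * n + 1 by omega, W.clearedEval_X_mul ((Polynomial.natDegree_C_mul_le _ _).trans hM),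
        clearedEval_C_mul, ← hℳ]
      ring
    have hpol : φO * (Polynomial.X * Polynomial.derivative U₀) - 2 * (U₀ * (Polynomial.X * Polynomial.derivative φO)) =
        Polynomial.X * (Polynomial.C (p : 𝒪) * M₀) := by
      rw [← hMder]; ring
    have h4 := congrArg (W.clearedEval (n + p)) hpol
    rw [clearedEval_sub, show (2 : 𝒪[X]) * (U₀ * (Polynomial.X * Polynomial.derivative φO)) =
        Polynomial.C (2 : 𝒪) * (U₀ * (Polynomial.X * Polynomial.derivative φO)) by rw [map_ofNat],
      clearedEval_C_mul, h1, h2, h3, map_ofNat] at h4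
    linear_combination h4
  -- assemble: `η(t_pP^• - 2Pt_p^•) = u³(Φ·𝒟_{2p}𝒰 - 2𝒰·𝒟_{2n}Φ)` since `2p - 2 - 4n = 0`
  have hdefU : W.clearedDeriv (2 * p) 𝒰 = W.formalEta * (X * d⁄dX 𝒪 𝒰 - ((2 * p : ℕ) : 𝒪⟦X⟧) * 𝒰) := rfl
  have hdefΦ : W.clearedDeriv (2 * n) Φ = W.formalEta * (X * d⁄dX 𝒪 Φ - ((2 * n : ℕ) : 𝒪⟦X⟧) * Φ) := rfl
  have hpn : ((2 * p : ℕ) : 𝒪⟦X⟧) = 2 * ((2 * n : ℕ) : 𝒪⟦X⟧) + 2 := by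
    rw [← hp]; push_cast; ring
  rw [hpn] at hdefU
  rw [htp, show W.clearedEval p U₀ * u ^ 2 = 𝒰 * (u * u) by rw [h𝒰, pow_two]]
  simp only [Derivation.leibniz, derivative_X, smul_eq_mul]
  linear_combination (-(u ^ 3 * Φ)) * hdefU + (2 * u ^ 3 * 𝒰) * hdefΦ + (u ^ 3 * Φ) * hDU -
    (2 * u ^ 3 * 𝒰) * hDΦ - (2 * u ^ 3) * hkey - (2 * C (p : 𝒪) * u ^ 2) * hunit

end ImagePoint

end WeierstrassCurve

/-! ### Assembly over `R̂`: the named fact from the output of `VeluKernelReductionProofs` -/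

namespace Literature.NumberTheory.EllipticCurves.UniversalOrdinary

open WeierstrassCurve

/-- Coefficientwise reading of `map (mk p) F = 0`. [folklore] -/
theorem coeff_mem_span_of_map_mk_eq_zero {R : Type*} [CommRing R] (I : Ideal R) {F : PowerSeries R}
    (h : PowerSeries.map (Ideal.Quotient.mk I) F = 0) (k : ℕ) : coeff k F ∈ I := by
  have h1 : Ideal.Quotient.mk I (coeff k F) = 0 := by rw [← coeff_map, h]; rfl
  exact Ideal.Quotient.eq_zero_iff_mem.mp h1

set_option maxHeartbeats 1600000 in
/-- **Thm. 1 over `R̂` for one prime from the data of `VeluKernelReductionProofs`.** For `p = 2n+1 ≥ 5`,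
`𝓔 = universalCurve p` over `R̂`, `K = R̂[1/p]`, suppose given polynomials `φ, U, M ∈ R̂[X]` and
`A₀, B₀ ∈ R̂` with the conclusions of `exists_veluU_lift`, `exists_veluMD_lift`, `exists_veluAB_lift`
(degrees, `U ≡ Xᵖ`, `M ≡ fⁿ`, `φ ≡ ℓ₀ ∈ R̂ˣ (mod p)`, `[Xⁿ]φ = p`, `[Xᵖ]U = 1`,
`f·M² = U³ + A₀Uφ⁴ + B₀φ⁶`, `A₀ℓ₀⁴ ≡ A₄ᵖ`, `B₀ℓ₀⁶ ≡ A₆ᵖ`), the normalisation `U'φ - 2Uφ' = p·M`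
(`veluMD = U'D - 2UD'`, `φ = pD`), and over `K` the logarithmic form of `U`
(`veluU_eq_logForm`: `U = (pX - T₀)D² - 𝓛(D)`, `pD = φ`). Then for every even zeta series `Λ`
of `𝓔`, `exp(∫ζ̃ω) ∈ R̂⟦t⟧`. The isogeny data of `PadicSigmaKohelCriterionProofs` are
`α = frobeniusLift` at `(A₀ℓ₀⁴, B₀ℓ₀⁶)`, `T' = ℓ₀⁻¹·t_p` (`t_p = veluFormalIsog`),
`u = veluFormalUnit`, `π = p/ℓ₀`; the identities `X'(T') = ev_p(U)u²`, `ω'(T')dT' = πω` are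
`sq_velu_image`, `formalEta_mul_velu_image` read through the chart of `𝓔'`
(`FormalGroupChartUniquenessProofs`). [Blakestad–Grant 2023, Thm. 1, Prop. 7, Lemma 12, Prop. 13]
[cite: BlakestadGrant2023, Thm. 1] -/
theorem coeff_exp_sigmaExpArg_universalCurve_mem_of_veluKernelData (p : ℕ) [Fact p.Prime] (hp5 : 5 ≤ p)
    {n : ℕ} (hnp : 2 * n + 1 = p) {φO U₀ M₀ : (completeRing p)[X]} {A₀ B₀ : completeRing p}
    {D : (completeRingQ p)[X]} {T₀ : completeRingQ p}
    (hφ : φO.natDegree ≤ n) (hφn : φO.coeff n = p)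
    (hφp : ∀ i, 1 ≤ i → (p : completeRing p) ∣ φO.coeff i) (hℓ : IsUnit (φO.coeff 0))
    (hU : U₀.natDegree ≤ p) (hUp1 : U₀.coeff p = 1)
    (hUp : ∀ i, (p : completeRing p) ∣ (U₀ - Polynomial.X ^ p).coeff i)
    (hM : M₀.natDegree ≤ 3 * n) (hM1 : M₀.coeff (3 * n) = 1)
    (hMp : ∀ i, (p : completeRing p) ∣ (M₀ - (Polynomial.X ^ 3 + Polynomial.C (univA₄ p) * Polynomial.X +
      Polynomial.C (univA₆ p)) ^ n).coeff i)
    (hAB : (Polynomial.X ^ 3 + Polynomial.C (univA₄ p) * Polynomial.X + Polynomial.C (univA₆ p)) * M₀ ^ 2 =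
      U₀ ^ 3 + Polynomial.C A₀ * U₀ * φO ^ 4 + Polynomial.C B₀ * φO ^ 6)
    (hA : (p : completeRing p) ∣ A₀ * φO.coeff 0 ^ 4 - univA₄ p ^ p)
    (hB : (p : completeRing p) ∣ B₀ * φO.coeff 0 ^ 6 - univA₆ p ^ p)
    (hMder : Polynomial.derivative U₀ * φO - 2 * U₀ * Polynomial.derivative φO = Polynomial.C (p : completeRing p) * M₀)
    (hD : Polynomial.C (p : completeRingQ p) * D = φO.map (algebraMap (completeRing p) (completeRingQ p)))
    (hUlog : U₀.map (algebraMap (completeRing p) (completeRingQ p)) =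
      (Polynomial.C (p : completeRingQ p) * Polynomial.X - Polynomial.C T₀) * D ^ 2 -
        ((universalCurve p).map (algebraMap (completeRing p) (completeRingQ p))).veluLogOp D)
    {β : completeRing p} {Λ : PowerSeries (completeRing p)} (h0 : constantCoeff Λ = 1)
    (hev : rescale (-1 : completeRing p) Λ = Λ)
    (hΛ : X * d⁄dX (completeRing p) Λ - Λ =
      -(((universalCurve p).formalXMulSq - C β * X ^ 2) * (universalCurve p).formalInvDiff)) (k : ℕ) :
    coeff k ((exp (completeRingQ p)).subst
      (((universalCurve p).map (algebraMap (completeRing p) (completeRingQ p))).sigmaExpArg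
        (PowerSeries.map (algebraMap (completeRing p) (completeRingQ p)) Λ))) ∈ intSubring p := by
  set ι : completeRing p →+* completeRingQ p := algebraMap (completeRing p) (completeRingQ p) with hι
  set E := universalCurve p with hE
  set EK := E.map ι with hEK
  haveI : EK.IsCharNeTwoNF := by refine ⟨?_, ?_⟩ <;> simp [hEK, hE, universalCurve]
  have hn : 1 ≤ n := by omega
  -- units: `ℓ₀`, its inverse `cR`, `p ∈ Kˣ`
  set ℓ₀ := φO.coeff 0 with hℓ₀
  set cR : completeRing p := ↑hℓ.unit⁻¹ with hcR
  have hcℓ : cR * ℓ₀ = 1 := hℓ.val_inv_mul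
  have hpK : IsUnit (p : completeRingQ p) := isUnit_natCast_prime_completeRingQ p
  obtain ⟨pinv, hpinv⟩ := hpK.exists_left_inv
  set c : completeRingQ p := ι cR with hc
  have hcK : c * ι ℓ₀ = 1 := by rw [hc, ← map_mul, hcℓ, map_one]
  set π : completeRingQ p := (p : completeRingQ p) * c with hπ
  have hπu : IsUnit π := hpK.mul (isUnit_iff_exists_inv.mpr ⟨ι ℓ₀, hcK⟩)
  -- S1: the Frobenius lift and `𝓔'`
  set A'₄ : completeRing p := A₀ * ℓ₀ ^ 4 with hA'₄
  set A'₆ : completeRing p := B₀ * ℓ₀ ^ 6 with hA'₆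
  have h₄ : A'₄ - univA₄ p ^ p ∈ Ideal.span {(p : completeRing p)} := Ideal.mem_span_singleton.mpr hA
  have h₆ : A'₆ - univA₆ p ^ p ∈ Ideal.span {(p : completeRing p)} := Ideal.mem_span_singleton.mpr hB
  set α := frobeniusLift p A'₄ A'₆ h₄ h₆ with hα
  set E' := E.map α with hE'
  have ha₁ : (E'.map ι).a₁ = 0 := by simp [hE', hE, universalCurve]
  have ha₂ : (E'.map ι).a₂ = 0 := by simp [hE', hE, universalCurve]
  have ha₃ : (E'.map ι).a₃ = 0 := by simp [hE', hE, universalCurve]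
  have ha₄ : (E'.map ι).a₄ = ι A'₄ := congrArg ι (frobeniusLift_univA₄ p A'₄ A'₆ h₄ h₆)
  have ha₆ : (E'.map ι).a₆ = ι A'₆ := congrArg ι (frobeniusLift_univA₆ p A'₄ A'₆ h₄ h₆)
  -- S2: `u`, `t_p`, `T = ℓ₀⁻¹ t_p` over `R̂`
  set u := E.veluFormalUnit U₀ M₀ p n with hu
  set tp := E.veluFormalIsog φO U₀ M₀ p n with htp
  set 𝒰 := E.clearedEval p U₀ with h𝒰
  set Φ := E.clearedEval n φO with hΦ
  set T : PowerSeries (completeRing p) := C cR * tp with hT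
  have htp0 : constantCoeff tp = 0 := WeierstrassCurve.constantCoeff_veluFormalIsog _ _ _ _ _
  have hT0 : constantCoeff T = 0 := by rw [hT, map_mul, htp0, mul_zero]
  have htpmod := WeierstrassCurve.map_veluFormalIsog_sub (W := E) hnp hφ hφp hU hUp hM hM1 hMp
  have hTmod : ∀ i, coeff i T - (if i = p then 1 else 0) ∈ Ideal.span {(p : completeRing p)} := by
    intro i
    have hi := coeff_mem_span_of_map_mk_eq_zero _ htpmod i
    have e : coeff i T - (if i = p then 1 else 0) = cR * coeff i (tp - C ℓ₀ * X ^ p) := by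
      rw [hT, coeff_C_mul, map_sub, coeff_C_mul, coeff_X_pow, mul_sub, ← mul_assoc, hcℓ, one_mul]
    rw [e]; exact Ideal.mul_mem_left _ _ hi
  have hu0 : constantCoeff u = 1 := by
    rw [hu, WeierstrassCurve.veluFormalUnit, map_mul, E.constantCoeff_clearedEval hU, hUp1, one_mul, constantCoeff_invOfUnit,
      inv_one, Units.val_one]
  have humod := WeierstrassCurve.map_veluFormalUnit_sub_one (W := E) hnp hU hUp hM hM1 hMp
  have hu' : ∀ i, coeff (i + 1) u ∈ Ideal.span {(p : completeRing p)} := by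
    intro i
    have := coeff_mem_span_of_map_mk_eq_zero _ humod (i + 1)
    rwa [map_sub, coeff_one, if_neg (Nat.succ_ne_zero i), sub_zero] at this
  have hu1 : coeff 1 u = 0 := by
    set Q := E.formalXMulSq * E.clearedEval (3 * n) M₀ with hQ
    have hQ0 : constantCoeff Q = 1 := WeierstrassCurve.constantCoeff_formalXMulSq_mul_clearedEval hM hM1
    have hQ1 : coeff 1 Q = 0 := by
      rw [hQ, coeff_mul, Finset.Nat.antidiagonal_succ, Finset.sum_cons, Finset.Nat.antidiagonal_zero, Finset.map_singleton,
        Finset.sum_singleton]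
      have ha1E : E.a₁ = 0 := rfl
      simp only [Function.Embedding.coe_prodMap, Function.Embedding.coeFn_mk, Prod.map_apply, Nat.succ_eq_add_one,
        zero_add, Function.Embedding.refl_apply, coeff_zero_eq_constantCoeff_apply]
      rw [E.coeff_one_clearedEval hM, E.coeff_one_formalXMulSq, ha1E, neg_zero, zero_mul, add_zero, mul_zero]
    set v := Q.invOfUnit 1 with hv
    have hQv : Q * v = 1 := mul_invOfUnit Q 1 (by rw [hQ0, Units.val_one])
    have hv0 : constantCoeff v = 1 := by rw [hv, constantCoeff_invOfUnit, inv_one, Units.val_one]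
    have hv1 : coeff 1 v = 0 := by
      have h := congrArg (coeff 1) hQv
      rw [coeff_mul, Finset.Nat.antidiagonal_succ, Finset.sum_cons, Finset.Nat.antidiagonal_zero, Finset.map_singleton,
        Finset.sum_singleton, coeff_one, if_neg one_ne_zero] at h
      simp only [Function.Embedding.coe_prodMap, Function.Embedding.coeFn_mk, Prod.map_apply, Nat.succ_eq_add_one,
        zero_add, Function.Embedding.refl_apply, coeff_zero_eq_constantCoeff_apply, hQ0, one_mul, hQ1, zero_mul,
        add_zero] at h
      exact h
    rw [hu, WeierstrassCurve.veluFormalUnit, ← hQ, ← hv, coeff_mul, Finset.Nat.antidiagonal_succ, Finset.sum_cons,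
      Finset.Nat.antidiagonal_zero, Finset.map_singleton, Finset.sum_singleton]
    simp only [Function.Embedding.coe_prodMap, Function.Embedding.coeFn_mk, Prod.map_apply, Nat.succ_eq_add_one,
      zero_add, Function.Embedding.refl_apply, coeff_zero_eq_constantCoeff_apply, hv1, mul_zero,
      E.coeff_one_clearedEval hU, zero_mul, add_zero]
  -- S3: over `K`: `D = φ/p`, `N = ev_n(D)`, `T = π·t·N·u`
  have hDeq : D = Polynomial.C pinv * φO.map ι := by
    rw [← hD, ← mul_assoc, ← Polynomial.C_mul, hpinv, Polynomial.C_1, one_mul]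
  have hDn : D.natDegree ≤ n := by
    rw [hDeq]; exact (Polynomial.natDegree_C_mul_le _ _).trans (Polynomial.natDegree_map_le.trans hφ)
  have hDc : D.coeff n = 1 := by
    rw [hDeq, Polynomial.coeff_C_mul, Polynomial.coeff_map, hφn, map_natCast, hpinv]
  set N := EK.clearedEval n D with hN
  have hN0 : constantCoeff N = 1 := by rw [hN, EK.constantCoeff_clearedEval hDn, hDc]
  have hΦK : PowerSeries.map ι Φ = C (p : completeRingQ p) * N := by
    rw [hΦ, E.map_clearedEval ι hφ, ← hEK, ← hD, WeierstrassCurve.clearedEval_C_mul, ← hN]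
  have h𝒰K : PowerSeries.map ι 𝒰 = EK.clearedEval p (U₀.map ι) := by rw [h𝒰, E.map_clearedEval ι hU, ← hEK]
  have htpK : PowerSeries.map ι tp = C (ι ℓ₀) * PowerSeries.map ι T := by
    rw [hT, map_mul, map_C, ← hc, ← mul_assoc, ← map_mul, mul_comm (ι ℓ₀), hcK, map_one, one_mul]
  have hTu : PowerSeries.map ι T = C π * X * N * PowerSeries.map ι u := by
    rw [hT, map_mul, map_C, ← hc, htp, WeierstrassCurve.veluFormalIsog, map_mul, map_mul, map_X, ← hΦ, hΦK, ← hu, hπ, map_mul]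
    ring
  have hT0K : constantCoeff (PowerSeries.map ι T) = 0 := by
    rw [← coeff_zero_eq_constantCoeff_apply, coeff_map, coeff_zero_eq_constantCoeff_apply, hT0, map_zero]
  have hu0K : constantCoeff (PowerSeries.map ι u) = 1 := WeierstrassCurve.constantCoeff_map_eq_one ι hu0
  -- S4: `X'(T) = 𝒰u²` through the chart of `𝓔'`
  set P : PowerSeries (completeRingQ p) := PowerSeries.map ι 𝒰 * PowerSeries.map ι u ^ 2 with hP
  have hP0 : constantCoeff P = 1 := by
    rw [hP, map_mul, map_pow, hu0K, one_pow, mul_one, ← coeff_zero_eq_constantCoeff_apply, coeff_map,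
      coeff_zero_eq_constantCoeff_apply, h𝒰, E.constantCoeff_clearedEval hU, hUp1, map_one]
  have hsqR := WeierstrassCurve.sq_velu_image (W := E) hnp hφ hU hM hM1 (by
    simpa only [hE, show (universalCurve p).a₄ = univA₄ p from rfl, show (universalCurve p).a₆ = univA₆ p from rfl]
      using hAB)
  have heq : P ^ 2 = P ^ 3 + C (E'.map ι).a₁ * PowerSeries.map ι T * P ^ 2 +
      C (E'.map ι).a₂ * PowerSeries.map ι T ^ 2 * P ^ 2 + C (E'.map ι).a₃ * PowerSeries.map ι T ^ 3 * P +
      C (E'.map ι).a₄ * PowerSeries.map ι T ^ 4 * P + C (E'.map ι).a₆ * PowerSeries.map ι T ^ 6 := by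
    have h := congrArg (PowerSeries.map ι) hsqR
    rw [← hu, ← htp, ← h𝒰] at h
    rw [ha₁, ha₂, ha₃, ha₄, ha₆, hA'₄, hA'₆, hP]
    simp only [map_zero, zero_mul, add_zero, map_pow, map_mul, map_add, map_C] at h ⊢
    rw [htpK] at h
    -- `C(ιA₀)·(ℓ₀T)⁴ = C(ι(A₀ℓ₀⁴))·T⁴`, etc.
    linear_combination h
  have hX : (E'.map ι).formalXMulSq.subst (PowerSeries.map ι T) = P :=
    (E'.map ι).formalXMulSq_subst_eq_of_sq_eq hT0K hP0 heq
  -- S5: `ω'(T)dT = πω`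
  have hηlem := (E'.map ι).formalEta_subst_mul_eq hT0K hP0 heq
  rw [ha₁, ha₃] at hηlem
  simp only [map_zero, zero_mul, zero_sub, add_zero] at hηlem
  have hV2R := WeierstrassCurve.formalEta_mul_velu_image (W := E) hnp hφ hU hM hM1 hMder
  have hV2 : EK.formalEta * (PowerSeries.map ι T * d⁄dX (completeRingQ p) P - 2 * P * d⁄dX (completeRingQ p) (PowerSeries.map ι T)) =
      -2 * C π * P := by
    have h := congrArg (PowerSeries.map ι) hV2R
    rw [← hu, ← htp, ← h𝒰] at h
    simp only [map_mul, map_sub, map_pow, map_neg, map_natCast, map_ofNat, E.map_formalEta ι,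
      ← derivative_map] at h
    rw [← hEK, ← hP, htpK] at h
    -- `h : η·(ℓ₀T·P^• - 2P·(ℓ₀T)^•) = -2pP`; divide by `ℓ₀`
    have hder : d⁄dX (completeRingQ p) (C (ι ℓ₀) * PowerSeries.map ι T) = C (ι ℓ₀) * d⁄dX (completeRingQ p) (PowerSeries.map ι T) := by
      rw [Derivation.leibniz, derivative_C, smul_zero, add_zero, smul_eq_mul]
    rw [hder] at h
    have hcc : C c * C (ι ℓ₀) = (1 : PowerSeries (completeRingQ p)) := by rw [← map_mul, hcK, map_one]
    have hCπ : C π = (p : PowerSeries (completeRingQ p)) * C c := by rw [hπ, map_mul, map_natCast]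
    rw [hCπ]
    linear_combination C c * h - (EK.formalEta *
      (PowerSeries.map ι T * d⁄dX (completeRingQ p) P - 2 * P * d⁄dX (completeRingQ p) (PowerSeries.map ι T))) * hcc
  have hTω : (E'.map ι).formalInvDiff.subst (PowerSeries.map ι T) * d⁄dX (completeRingQ p) (PowerSeries.map ι T) =
      C π * EK.formalInvDiff := by
    have hsT : HasSubst (PowerSeries.map ι T) := HasSubst.of_constantCoeff_zero' hT0K
    set Z := PowerSeries.map ι T * d⁄dX (completeRingQ p) P - 2 * P * d⁄dX (completeRingQ p) (PowerSeries.map ι T) with hZ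
    have hT1 : coeff 1 (PowerSeries.map ι T) = π := by
      rw [coeff_map, hT, coeff_C_mul, htp, WeierstrassCurve.coeff_one_veluFormalIsog hφ hU, hφn, hUp1, mul_one, map_mul,
        map_natCast, ← hc, hπ, mul_comm]
    have h2u : IsUnit (2 : completeRingQ p) := by
      have := isUnit_natCast_completeRingQ p (n := 2) two_ne_zero
      rwa [Nat.cast_ofNat] at this
    have hZ0 : constantCoeff Z = -(2 * π) := by
      rw [hZ, map_sub, map_mul, hT0K, zero_mul, zero_sub, map_mul, map_mul, hP0, mul_one,
        ← coeff_zero_eq_constantCoeff_apply (d⁄dX (completeRingQ p) _), coeff_derivative, zero_add, Nat.cast_zero, zero_add,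
        mul_one, hT1, map_ofNat]
    have hZu : IsUnit Z := by
      rw [isUnit_iff_constantCoeff, hZ0, IsUnit.neg_iff]
      exact h2u.mul hπu
    have hηform : C π * (E'.map ι).formalEta.subst (PowerSeries.map ι T) = EK.formalEta * d⁄dX (completeRingQ p) (PowerSeries.map ι T) := by
      have h1 : Z * (C π * (E'.map ι).formalEta.subst (PowerSeries.map ι T) - EK.formalEta * d⁄dX (completeRingQ p) (PowerSeries.map ι T)) = 0 := by
        linear_combination C π * hηlem - d⁄dX (completeRingQ p) (PowerSeries.map ι T) * hV2
      exact sub_eq_zero.mp (hZu.mul_right_eq_zero.mp h1)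
    have hηW' : (E'.map ι).formalEta.subst (PowerSeries.map ι T) * (E'.map ι).formalInvDiff.subst (PowerSeries.map ι T) = 1 := by
      rw [← subst_mul hsT, (E'.map ι).formalEta_mul_formalInvDiff, one_subst hsT]
    have hηW := EK.formalEta_mul_formalInvDiff
    linear_combination (-((E'.map ι).formalInvDiff.subst (PowerSeries.map ι T) * EK.formalInvDiff)) * hηform +
      (C π * EK.formalInvDiff) * hηW' - ((E'.map ι).formalInvDiff.subst (PowerSeries.map ι T) *
        d⁄dX (completeRingQ p) (PowerSeries.map ι T)) * hηW
  -- S6: the Vélu-level identity in `ρ`-form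
  have hpc : ((2 * n + 1 : ℕ) : completeRingQ p) = (p : completeRingQ p) := by rw [hnp]
  have hU' : U₀.map ι = (Polynomial.C ((2 * n + 1 : ℕ) : completeRingQ p) * Polynomial.X - Polynomial.C T₀) * D ^ 2 - EK.veluLogOp D := by
    rw [hpc]; exact hUlog
  have hevU := EK.clearedEval_logForm hn hDn hU'
  rw [hnp] at hevU
  have hpX : (p : PowerSeries (completeRingQ p)) = 2 * (n : PowerSeries (completeRingQ p)) + 1 := by rw [← hnp]; push_cast; ring
  have hV : (E'.map ι).formalXMulSq.subst (PowerSeries.map ι T) =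
      ((p : PowerSeries (completeRingQ p)) * EK.formalXMulSq * N ^ 2 +
        ((p : PowerSeries (completeRingQ p)) - 1) * (X * EK.formalEta * d⁄dX (completeRingQ p) EK.formalEta - EK.formalEta ^ 2) * N ^ 2 -
        X ^ 2 * logDeriv₂Num EK.formalInvariantDerivation N - C T₀ * X ^ 2 * N ^ 2) * PowerSeries.map ι u ^ 2 := by
    rw [hX, hP, h𝒰K, hevU, hpX]
    ring
  have hBρ := WeierstrassCurve.formalXReg_rel_of_velu p hπu hN0 hu0K hTu hTω hV
  exact coeff_exp_sigmaExpArg_universalCurve_mem' p hp5 h₄ h₆ hT0 hTmod hu0 hu1 hu' hTω hBρ h0 hev hΛ k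

/-- **`WeierstrassCurve.mazur_tate_sigma_existsUnique` (Mazur–Stein–Tate 2006, Thm. 1.3) from the
output of `VeluKernelReductionProofs` for the canonical subgroup of the universal ordinary curve.**
For every `p ≥ 5` suppose given `n` (`p = 2n+1`), polynomials `φ, U, M ∈ R̂[X]`, scalars
`A₀, B₀ ∈ R̂`, `D ∈ K[X]`, `T₀ ∈ K` (`K = R̂[1/p]`) with: `deg φ ≤ n`, `[Xⁿ]φ = p`, `p ∣ [Xⁱ]φ`
(`i ≥ 1`), `[X⁰]φ ∈ R̂ˣ`; `deg U ≤ p`, `[Xᵖ]U = 1`, `U ≡ Xᵖ`; `deg M ≤ 3n`, `[X³ⁿ]M = 1`,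
`M ≡ (X³ + A₄X + A₆)ⁿ (mod p)`; `(X³ + A₄X + A₆)M² = U³ + A₀Uφ⁴ + B₀φ⁶`; `A₀φ₀⁴ ≡ A₄ᵖ`,
`B₀φ₀⁶ ≡ A₆ᵖ`; `U'φ - 2Uφ' = p·M`; `pD = φ` and `U = (pX - T₀)D² - 𝓛(D)` over `K` — exactly the
conclusions of `exists_veluU_lift`, `exists_veluMD_lift`, `exists_veluAB_lift` (with
`veluMD = U'D - 2UD'`, `veluU_eq_logForm`) for a kernel of order `p` with kernel polynomial `D` of
Blakestad–Grant's canonical type (4). Then the named fact holds. [Blakestad–Grant 2023, Thm. 1,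
Prop. 7, Lemmas 10–12, Prop. 13; Mazur–Stein–Tate 2006, Thm. 1.3] [cite: BlakestadGrant2023, Thm. 1] -/
theorem mazur_tate_sigma_existsUnique_of_veluKernelData
    (H : ∀ (p : ℕ) [Fact p.Prime], 5 ≤ p →
      ∃ (n : ℕ) (_ : 2 * n + 1 = p) (φO U₀ M₀ : (completeRing p)[X]) (A₀ B₀ : completeRing p)
        (D : (completeRingQ p)[X]) (T₀ : completeRingQ p),
        φO.natDegree ≤ n ∧ φO.coeff n = p ∧ (∀ i, 1 ≤ i → (p : completeRing p) ∣ φO.coeff i) ∧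
        IsUnit (φO.coeff 0) ∧
        U₀.natDegree ≤ p ∧ U₀.coeff p = 1 ∧ (∀ i, (p : completeRing p) ∣ (U₀ - Polynomial.X ^ p).coeff i) ∧
        M₀.natDegree ≤ 3 * n ∧ M₀.coeff (3 * n) = 1 ∧
        (∀ i, (p : completeRing p) ∣ (M₀ - (Polynomial.X ^ 3 + Polynomial.C (univA₄ p) * Polynomial.X +
          Polynomial.C (univA₆ p)) ^ n).coeff i) ∧
        (Polynomial.X ^ 3 + Polynomial.C (univA₄ p) * Polynomial.X + Polynomial.C (univA₆ p)) * M₀ ^ 2 =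
          U₀ ^ 3 + Polynomial.C A₀ * U₀ * φO ^ 4 + Polynomial.C B₀ * φO ^ 6 ∧
        (p : completeRing p) ∣ A₀ * φO.coeff 0 ^ 4 - univA₄ p ^ p ∧
        (p : completeRing p) ∣ B₀ * φO.coeff 0 ^ 6 - univA₆ p ^ p ∧
        Polynomial.derivative U₀ * φO - 2 * U₀ * Polynomial.derivative φO = Polynomial.C (p : completeRing p) * M₀ ∧
        Polynomial.C (p : completeRingQ p) * D = φO.map (algebraMap (completeRing p) (completeRingQ p)) ∧
        U₀.map (algebraMap (completeRing p) (completeRingQ p)) =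
          (Polynomial.C (p : completeRingQ p) * Polynomial.X - Polynomial.C T₀) * D ^ 2 -
            ((universalCurve p).map (algebraMap (completeRing p) (completeRingQ p))).veluLogOp D) :
    WeierstrassCurve.mazur_tate_sigma_existsUnique := by
  refine WeierstrassCurve.mazur_tate_sigma_existsUnique_of_universal_exp_sigmaExpArg_integral'
    fun p _ hp5 β Λ h0 hev hΛ => ?_
  obtain ⟨n, hnp, φO, U₀, M₀, A₀, B₀, D, T₀, hφ, hφn, hφp, hℓ, hU, hUp1, hUp, hM, hM1, hMp, hAB, hA, hB, hMder, hD,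
    hUlog⟩ := H p hp5
  exact coeff_exp_sigmaExpArg_universalCurve_mem_of_veluKernelData p hp5 hnp hφ hφn hφp hℓ hU hUp1 hUp hM hM1 hMp
    hAB hA hB hMder hD hUlog h0 hev hΛ

end Literature.NumberTheory.EllipticCurves.UniversalOrdinary
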